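import Mathlib.NumberTheory.EulerProduct.DirichletLSeries
import Mathlib.NumberTheory.LSeries.HurwitzZetaValues
import Mathlib.Analysis.Real.Pi.Bounds
import Literature.NumberTheory.LFunctions.Hinkkanen1997.BernoulliTable
import HarnessLib

/-!
# Bhargava–Skinner–Zhang 2014, §2.3 / §3.1: the density of semistable reduction as an Euler product — `ζ(10)/ζ(2) = 2π⁸/31185`, the closed form `SEMI = π⁸·4921·406901/(31185·128·6561·390625)` and its 13-digit enclosure, kernel-checked

Source: M. Bhargava, C. Skinner, W. Zhang, *A majority of elliptic curves over `ℚ` satisfy the Birch and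
Swinnerton-Dyer conjecture*, arXiv:1407.1826v2 (2014) [BhargavaSkinnerZhang2014], §2.3 (p. 5: "the family of all
semistable elliptic curves is also large") and §3.1 (p. 7: for a large family `F` defined by congruence conditions
the density is the product of the local densities, `μ(F) = ∏_ℓ μ_ℓ(F)` with `μ_ℓ(F) = μ_ℓ(Σ_ℓ)/(1 - ℓ⁻¹⁰)`, by their
reference [BS2] = [BhargavaShankarAnnals2015, Thm 3.17]).  Page numbers are those of the compiled arXiv v2 PDF
(checked by the `pub-bsdpct` literature audit, 2026-08-18).

Reproduction (proved; Mathlib plus the tree's Bernoulli table): the density of "semistable at every prime `ℓ ≠ 5`"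
in the height family `y² = x³ + Ax + B`,

  `SEMI = μ₂(semistable) · μ₃(semistable) · ∏_{ℓ ≥ 7 prime} (1 - ℓ⁻²)/(1 - ℓ⁻¹⁰) = (1/341)·(4921/7381)·SEMI_ge7`,

as a genuine unconditional infinite product with a closed form and a certified enclosure:
* `riemannZeta_ten`        : `ζ(10) = π¹⁰/93555` (from `B₁₀ = 5/66` = the tree's `bernoulli'_10`, and Mathlib's
                             `riemannZeta_two_mul_nat`; `riemannZeta_two` is Mathlib's);
* `hasProd_localFactor`    : `∏_{ℓ prime} (1 - ℓ⁻²)/(1 - ℓ⁻¹⁰)` converges (as a `HasProd` over `Nat.Primes`) to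
                             `ζ(10)/ζ(2) = 2π⁸/31185` (Mathlib's `riemannZeta_eulerProduct_hasProd`);
* `hasProd_localFactor_ge7`, `SEMI_ge7_eq`, `SEMI_eq`, `SEMI_all_eq` : removing the Euler factors at `2, 3, 5`
                             (`256/341`, `6561/7381`, `390625/406901`) gives
                             `SEMI_ge7 = (2π⁸/31185)·(341/256)·(7381/6561)·(406901/390625)`,
                             `SEMI = π⁸·4921·406901/(31185·128·6561·390625)`, `SEMI_all = π⁸·4921/(31185·128·6561)`;
* `SEMI_ge7_bounds`, `SEMI_bounds`, `SEMI_all_bounds` : 13-digit enclosures, e.g.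
                             `1857185624167·10⁻¹⁵ < SEMI < 1857185624168·10⁻¹⁵`, from Mathlib's 20-digit bounds
                             `Real.pi_gt_d20` / `Real.pi_lt_d20`.

Dictionary and scope (stated, not formalised): for a prime `ℓ ≥ 5` an `ℓ`-minimal short model `y² = x³ + Ax + B`
has additive reduction at `ℓ` iff `ℓ ∣ A ∧ ℓ ∣ B`, so inside the height family (pairs with `ℓ⁴ ∣ A ∧ ℓ⁶ ∣ B`
removed) the relative density of semistable reduction at `ℓ` is `(1 - ℓ⁻²)/(1 - ℓ⁻¹⁰) = localFactor ℓ`; at `2` and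
`3` the densities `1/341` and `4921/7381` are Tate-algorithm masses (the `pub-bsdpct` bundle's certified constants
`μ2_semistable`, `μ3_semistable`, reproduced from [TateLNM476] in the companion census files); and the density of
the infinite intersection is the product of the local densities (source §3.1).  What the kernel checks is
everything downstream of that dictionary: the value of the infinite product and its enclosure.

Relation to the tree: `Literature.NumberTheory.EllipticCurves.hasProd_localFactor` (`BhargavaShankarEq31Proofs.lean`)
is a DIFFERENT Euler product (the `V`-mass product of Bhargava–Shankar eq. (31)); its `hasProd_inv₀` is the
`ℝ`-valued twin of the `ℂ`-valued one-liner below (kept apart by the sub-namespace).  `B'_5, …, B'_10` are NOT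
re-proved here (dedup rule): `B'_10 = 5/66` is `Literature.NumberTheory.LFunctions.Hinkkanen1997.bernoulli'_10`
(`BernoulliTable.lean`, which itself reuses `PeriodPair.bernoulli'_five/_six` of `UniformizationProofs.lean`, where
also `riemannZeta_six` lives); `bernoulli_ten` / `riemannZeta_ten` below are the two values Mathlib (v4.32.0) and
the tree still lack (Mathlib-upstream candidates).
Origin: `BSDPercentage/SemistableProduct.lean` (ll. 1–287 and the three Mathlib-only lemmas of its second half) of
the `pub-bsdpct` bundle's staged package (BirchSwinnertonDyer / bsd-percentage, run of record 72), namespace rewritten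
`BSDPercentage.SemistableProduct → Literature.NumberTheory.EllipticCurves.BhargavaSkinnerZhang2014.SemistableProduct`
(LEAN-IN-TREE rule, 2026-08-18); statements and proofs unchanged.

What is NOT here: the bridge to the bundle's certified-constants table and to its headline tiers
(`SEMI_enclosure`, `enclosuresHold_iff`, `mu3lower_le`, the tier-B⁺ / A′⁺ real-valued bounds and the printed
closed forms `703·π⁸/22448067840`, …) — that is bundle arithmetic and goes Summit-side with the height-percentage
theorems; the second Euler product `P₁` over `ℓ ≡ ±1 (mod 5)` (no closed form; certified by interval arithmetic
only, never used by a theorem); any statement about elliptic curves themselves (see the dictionary above).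
-/

open Filter Nat
open _root_.Topology

namespace Literature.NumberTheory.EllipticCurves.BhargavaSkinnerZhang2014.SemistableProduct

/-! ### `B₁₀ = 5/66` and `ζ(10) = π¹⁰/93555` -/

/-- `B₁₀ = 5/66` for Mathlib's `bernoulli` (the `B₁ = -1/2` convention; equal to `bernoulli'` at every index `≠ 1`),
from the tree's `bernoulli'_10`. [folklore] -/
theorem bernoulli_ten : bernoulli 10 = 5 / 66 := by
  rw [bernoulli_eq_bernoulli'_of_ne_one (by decide),
    Literature.NumberTheory.LFunctions.Hinkkanen1997.bernoulli'_10]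

/-- Euler: `ζ(10) = π¹⁰/93555`, from Mathlib's `riemannZeta_two_mul_nat` (`ζ(2k)` in terms of `B_{2k}`) at `k = 5`
and `B₁₀ = 5/66`. [folklore] -/
theorem riemannZeta_ten : riemannZeta 10 = (Real.pi : ℂ) ^ 10 / 93555 := by
  have h := riemannZeta_two_mul_nat (k := 5) (by norm_num)
  norm_num [Nat.factorial, bernoulli_ten] at h
  rw [h]
  ring

/-! ### The local factor -/

/-- Relative density of semistable reduction at a prime `ℓ ≥ 5` in the height family `y² = x³ + Ax + B`:
`localFactor ℓ = (1 - ℓ⁻²)/(1 - ℓ⁻¹⁰)` — additive reduction at an `ℓ`-minimal pair is `ℓ ∣ A ∧ ℓ ∣ B` (mass `ℓ⁻²`),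
and `1 - ℓ⁻¹⁰` is the mass of the `ℓ`-minimal pairs (the local density of a large family is
`μ_ℓ(Σ_ℓ)/(1 - ℓ⁻¹⁰)`). [cite: BhargavaSkinnerZhang2014, §3.1 (p. 7)] -/
noncomputable def localFactor (p : ℕ) : ℝ := (1 - ((p : ℝ) ^ 2)⁻¹) / (1 - ((p : ℝ) ^ 10)⁻¹)

/-- `localFactor 2 = (3/4)/(1023/1024) = 256/341`. [folklore] -/
theorem localFactor_two : localFactor 2 = 256 / 341 := by norm_num [localFactor]
/-- `localFactor 3 = (8/9)/(59048/59049) = 6561/7381`. [folklore] -/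
theorem localFactor_three : localFactor 3 = 6561 / 7381 := by norm_num [localFactor]
/-- `localFactor 5 = 390625/406901` (`= 1 - 16276/406901`, one minus the density of additive reduction at `5`). [folklore] -/
theorem localFactor_five : localFactor 5 = 390625 / 406901 := by norm_num [localFactor]

/-- `0 < localFactor ℓ` for every `ℓ ≥ 2`. [folklore] -/
theorem localFactor_pos {p : ℕ} (hp : 2 ≤ p) : 0 < localFactor p := by
  have h2 : (2 : ℝ) ≤ p := by exact_mod_cast hp
  have hp2 : (1 : ℝ) < (p : ℝ) ^ 2 := by nlinarith
  have hp10 : (1 : ℝ) < (p : ℝ) ^ 10 := by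
    calc (1 : ℝ) < (p : ℝ) ^ 2 := hp2
      _ ≤ (p : ℝ) ^ 10 := by exact pow_le_pow_right₀ (by linarith) (by norm_num)
  have a : 0 < 1 - ((p : ℝ) ^ 2)⁻¹ := by
    rw [sub_pos]; exact inv_lt_one_of_one_lt₀ hp2
  have b : 0 < 1 - ((p : ℝ) ^ 10)⁻¹ := by
    rw [sub_pos]; exact inv_lt_one_of_one_lt₀ hp10
  exact div_pos a b

/-- The complex Euler factors of `ζ(10)/ζ(2)` are the casts of `localFactor`:
`(localFactor ℓ : ℂ) = (1 - ℓ⁻¹⁰)⁻¹ · ((1 - ℓ⁻²)⁻¹)⁻¹`. [folklore] -/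
theorem localFactor_cast (p : ℕ) :
    (localFactor p : ℂ) = (1 - ((p : ℂ) ^ 10)⁻¹)⁻¹ * ((1 - ((p : ℂ) ^ 2)⁻¹)⁻¹)⁻¹ := by
  rw [inv_inv]
  push_cast [localFactor]
  ring

/-- For `ℓ ≥ 2`: `localFactor ℓ = 1 - μ_ℓ(additive box)` with `μ_ℓ(additive box) = (ℓ⁻² - ℓ⁻¹⁰)/(1 - ℓ⁻¹⁰)`. [folklore] -/
theorem localFactor_eq_one_sub {p : ℕ} (hp : 2 ≤ p) :
    localFactor p = 1 - (((p : ℝ) ^ 2)⁻¹ - ((p : ℝ) ^ 10)⁻¹) / (1 - ((p : ℝ) ^ 10)⁻¹) := by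
  have h2 : (2 : ℝ) ≤ p := by exact_mod_cast hp
  have hp10 : (1 : ℝ) < (p : ℝ) ^ 10 := by
    calc (1 : ℝ) < (2 : ℝ) ^ 10 := by norm_num
      _ ≤ (p : ℝ) ^ 10 := by gcongr
  have hne : (1 : ℝ) - ((p : ℝ) ^ 10)⁻¹ ≠ 0 := by
    have : ((p : ℝ) ^ 10)⁻¹ < 1 := inv_lt_one_of_one_lt₀ hp10
    linarith
  rw [localFactor, eq_sub_iff_add_eq, ← add_div, div_eq_one_iff_eq hne]
  ring

/-! ### Euler products -/

/-- If `∏ f = a ≠ 0` (as a `HasProd` in `ℂ`) then `∏ f⁻¹ = a⁻¹`. [folklore] -/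
theorem hasProd_inv₀ {β : Type*} {f : β → ℂ} {a : ℂ} (hf : HasProd f a) (ha : a ≠ 0) :
    HasProd (fun b ↦ (f b)⁻¹) a⁻¹ := by
  rw [HasProd] at *
  simp only [Finset.prod_inv_distrib]
  exact hf.inv₀ ha

/-- A real product converges to `a` if its complexification converges to `(a : ℂ)`. [folklore] -/
theorem hasProd_real_of_complex {β : Type*} {f : β → ℝ} {a : ℝ}
    (h : HasProd (fun b ↦ (f b : ℂ)) (a : ℂ)) : HasProd f a := by
  rw [HasProd] at *
  simp only [← Complex.ofReal_prod] at h
  exact Filter.tendsto_ofReal_iff.mp h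

/-- `∏_ℓ (1 - ℓ⁻²)/(1 - ℓ⁻¹⁰) = ζ(10)/ζ(2) = 2π⁸/31185` over all primes (unconditional product, from Mathlib's Euler
product for `ζ`, `ζ(2) = π²/6` and `ζ(10) = π¹⁰/93555`). [folklore] -/
theorem hasProd_localFactor :
    HasProd (fun p : Nat.Primes ↦ localFactor p) (2 * Real.pi ^ 8 / 31185) := by
  have h2 := riemannZeta_eulerProduct_hasProd (s := ((2 : ℕ) : ℂ)) (by simp)
  have h10 := riemannZeta_eulerProduct_hasProd (s := ((10 : ℕ) : ℂ)) (by simp)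
  simp only [Complex.cpow_neg, Complex.cpow_natCast] at h2 h10
  have hz2 : riemannZeta ((2 : ℕ) : ℂ) ≠ 0 :=
    riemannZeta_ne_zero_of_one_lt_re (by simp)
  have h := h10.mul (hasProd_inv₀ h2 hz2)
  apply hasProd_real_of_complex
  have hval : ((2 * Real.pi ^ 8 / 31185 : ℝ) : ℂ)
      = riemannZeta ((10 : ℕ) : ℂ) * (riemannZeta ((2 : ℕ) : ℂ))⁻¹ := by
    push_cast
    rw [riemannZeta_ten, riemannZeta_two]
    have hpi : (Real.pi : ℂ) ≠ 0 := Complex.ofReal_ne_zero.mpr Real.pi_ne_zero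
    field_simp
    ring
  rw [hval]
  convert h using 1
  funext p
  exact localFactor_cast p


/-! ### Restriction to the primes `ℓ ≥ 7` -/

/-- The prime `2` as an element of `Nat.Primes`. [folklore] -/
def two : Nat.Primes := ⟨2, Nat.prime_two⟩
/-- The prime `3` as an element of `Nat.Primes`. [folklore] -/
def three : Nat.Primes := ⟨3, Nat.prime_three⟩
/-- The prime `5` as an element of `Nat.Primes`. [folklore] -/
def five : Nat.Primes := ⟨5, Nat.prime_five⟩

/-- A prime `< 7` is `2`, `3` or `5`. [folklore] -/
theorem eq_of_lt_seven (p : Nat.Primes) (h : ¬ 7 ≤ (p : ℕ)) : p = two ∨ p = three ∨ p = five := by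
  obtain ⟨p, hp⟩ := p
  have h7 : p < 7 := by simpa using h
  interval_cases p
  · exact absurd hp (by decide)
  · exact absurd hp (by decide)
  · left; rfl
  · right; left; rfl
  · exact absurd hp (by decide)
  · right; right; rfl
  · exact absurd hp (by decide)

/-- The finitely supported correction that removes the Euler factors at `2`, `3`, `5`:
`corr ℓ = 1` for `ℓ ≥ 7`, `(localFactor ℓ)⁻¹` otherwise. [folklore] -/
noncomputable def corr (p : Nat.Primes) : ℝ := if 7 ≤ (p : ℕ) then 1 else (localFactor p)⁻¹

/-- `∏_ℓ corr ℓ = (localFactor 2)⁻¹ · (localFactor 3)⁻¹ · (localFactor 5)⁻¹` (a finite product in disguise). [folklore] -/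
theorem hasProd_corr :
    HasProd corr ((localFactor 2)⁻¹ * (localFactor 3)⁻¹ * (localFactor 5)⁻¹) := by
  have hS : ∀ p ∉ ({two, three, five} : Finset Nat.Primes), corr p = 1 := by
    intro p hp
    unfold corr
    split_ifs with h7
    · rfl
    · exfalso
      rcases eq_of_lt_seven p h7 with rfl | rfl | rfl <;> simp at hp
  have h : HasProd corr (∏ p ∈ ({two, three, five} : Finset Nat.Primes), corr p) :=
    hasProd_prod_of_ne_finset_one hS
  have h23 : two ∉ ({three, five} : Finset Nat.Primes) := by decide
  have h35 : three ∉ ({five} : Finset Nat.Primes) := by decide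
  rw [Finset.prod_insert h23, Finset.prod_insert h35, Finset.prod_singleton] at h
  have e2 : corr two = (localFactor 2)⁻¹ := by simp [corr, two]
  have e3 : corr three = (localFactor 3)⁻¹ := by simp [corr, three]
  have e5 : corr five = (localFactor 5)⁻¹ := by simp [corr, five]
  rw [e2, e3, e5, ← mul_assoc] at h
  exact h

/-- The indicator form of the product over `ℓ ≥ 7`:
`∏_ℓ [ℓ ≥ 7 ? localFactor ℓ : 1] = (2π⁸/31185) · (localFactor 2)⁻¹ (localFactor 3)⁻¹ (localFactor 5)⁻¹`. [folklore] -/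
theorem hasProd_indicator :
    HasProd (fun p : Nat.Primes ↦ if 7 ≤ (p : ℕ) then localFactor p else 1)
      (2 * Real.pi ^ 8 / 31185 * ((localFactor 2)⁻¹ * (localFactor 3)⁻¹ * (localFactor 5)⁻¹)) := by
  have h := hasProd_localFactor.mul hasProd_corr
  have hfun : (fun p : Nat.Primes ↦ if 7 ≤ (p : ℕ) then localFactor p else 1)
      = fun p : Nat.Primes ↦ localFactor p * corr p := by
    funext p
    unfold corr
    split_ifs with h7
    · simp
    · rw [mul_inv_cancel₀ (localFactor_pos p.2.two_le).ne']
  rw [hfun]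
  exact h

/-- `SEMI_ge7 := ∏_{ℓ ≥ 7 prime} (1 - ℓ⁻²)/(1 - ℓ⁻¹⁰)`, the density of semistable reduction at every prime
`ℓ ≥ 7` in the height family, as a genuine unconditional infinite product over the primes `≥ 7` (the product of
the local densities of a large family). [cite: BhargavaSkinnerZhang2014, §2.3 (p. 5) and §3.1 (p. 7)] -/
noncomputable def SEMI_ge7 : ℝ := ∏' p : {p : Nat.Primes // 7 ≤ (p : ℕ)}, localFactor p

/-- The product over the subtype of primes `≥ 7` converges to
`(2π⁸/31185) · (localFactor 2)⁻¹ (localFactor 3)⁻¹ (localFactor 5)⁻¹`. [folklore] -/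
theorem hasProd_localFactor_ge7 :
    HasProd (fun p : {p : Nat.Primes // 7 ≤ (p : ℕ)} ↦ localFactor p)
      (2 * Real.pi ^ 8 / 31185 * ((localFactor 2)⁻¹ * (localFactor 3)⁻¹ * (localFactor 5)⁻¹)) := by
  have h := hasProd_indicator
  have hfun : (fun p : Nat.Primes ↦ if 7 ≤ (p : ℕ) then localFactor p else 1)
      = Set.mulIndicator {p : Nat.Primes | 7 ≤ (p : ℕ)} (fun p ↦ localFactor p) := by
    funext p
    simp [Set.mulIndicator_apply]
  rw [hfun, ← hasProd_subtype_iff_mulIndicator] at h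
  exact h

/-- Closed form: `∏_{ℓ ≥ 7} (1 - ℓ⁻²)/(1 - ℓ⁻¹⁰) = (2π⁸/31185)·(341/256)·(7381/6561)·(406901/390625)`. [folklore] -/
theorem SEMI_ge7_eq :
    SEMI_ge7 = 2 * Real.pi ^ 8 / 31185 * (341 / 256 * (7381 / 6561) * (406901 / 390625)) := by
  rw [SEMI_ge7, hasProd_localFactor_ge7.tprod_eq, localFactor_two, localFactor_three, localFactor_five]
  norm_num

/-- `3.14159265358979323846⁸ < π⁸ < 3.14159265358979323847⁸`, from Mathlib's 20-digit bounds on `π`. [folklore] -/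
theorem pi_pow_eight_bounds :
    (3.14159265358979323846 : ℝ) ^ 8 < Real.pi ^ 8 ∧ Real.pi ^ 8 < (3.14159265358979323847 : ℝ) ^ 8 := by
  have hlo := Real.pi_gt_d20
  have hhi := Real.pi_lt_d20
  constructor
  · gcongr
  · gcongr

/-- The 13-digit enclosure `SEMI_ge7 = 0.9498861000538…`. [folklore] -/
theorem SEMI_ge7_bounds :
    (9498861000538 : ℝ) / 10 ^ 13 < SEMI_ge7 ∧ SEMI_ge7 < 9498861000539 / 10 ^ 13 := by
  obtain ⟨h1, h2⟩ := pi_pow_eight_bounds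
  rw [SEMI_ge7_eq]
  norm_num at h1 h2 ⊢
  constructor <;> linarith

/-- `SEMI := μ₂(semistable) · μ₃(semistable) · SEMI_ge7 = (1/341)·(4921/7381)·∏_{ℓ ≥ 7}(1 - ℓ⁻²)/(1 - ℓ⁻¹⁰)`, the
density of semistable reduction at every prime `ℓ ≠ 5` in the height family; the exact local densities `1/341`
at `2` and `4921/7381` at `3` are the Tate-algorithm masses of the companion census (certified constants
`μ2_semistable`, `μ3_semistable` of the bundle). [cite: BhargavaSkinnerZhang2014, §2.3 (p. 5) and §3.1 (p. 7)] -/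
noncomputable def SEMI : ℝ := 1 / 341 * (4921 / 7381) * SEMI_ge7

/-- Closed form: `SEMI = π⁸ · 4921 · 406901 / (31185 · 128 · 6561 · 390625)`. [folklore] -/
theorem SEMI_eq : SEMI = Real.pi ^ 8 * (4921 * 406901) / (31185 * 128 * 6561 * 390625) := by
  rw [SEMI, SEMI_ge7_eq]
  ring

/-- The enclosure `1857185624167·10⁻¹⁵ < SEMI < 1857185624168·10⁻¹⁵`, PROVED (from Mathlib's Euler product for
`ζ`, `ζ(2) = π²/6`, `ζ(10) = π¹⁰/93555` and the 20-digit bounds on `π`). [folklore] -/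
theorem SEMI_bounds : (1857185624167 : ℝ) / 10 ^ 15 < SEMI ∧ SEMI < 1857185624168 / 10 ^ 15 := by
  obtain ⟨h1, h2⟩ := pi_pow_eight_bounds
  rw [SEMI_eq]
  norm_num at h1 h2 ⊢
  constructor <;> linarith

/-! ### The all-primes product -/

/-- `SEMI_all := SEMI · localFactor 5 = ∏_{all ℓ} μ_ℓ(semistable)`, the density of square-free conductor
(semistable at every prime) in the height family. [cite: BhargavaSkinnerZhang2014, §2.3 (p. 5) and §3.1 (p. 7)] -/
noncomputable def SEMI_all : ℝ := SEMI * localFactor 5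

/-- Closed form: `SEMI_all = π⁸ · 4921 / (31185 · 128 · 6561)`. [folklore] -/
theorem SEMI_all_eq : SEMI_all = Real.pi ^ 8 * 4921 / (31185 * 128 * 6561) := by
  rw [SEMI_all, SEMI_eq, localFactor_five]
  ring

/-- `SEMI_all = 0.0017828983817…` (13 digits). [folklore] -/
theorem SEMI_all_bounds :
    (17828983817 : ℝ) / 10 ^ 13 < SEMI_all ∧ SEMI_all < 17828983818 / 10 ^ 13 := by
  obtain ⟨h1, h2⟩ := pi_pow_eight_bounds
  rw [SEMI_all_eq]
  norm_num at h1 h2 ⊢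
  constructor <;> linarith

end Literature.NumberTheory.EllipticCurves.BhargavaSkinnerZhang2014.SemistableProduct
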